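import Summits.CriticalPhenomena.PercolationContinuityZ3.Theorems.PercNearOneGluingNoHeavyLowerTailAttachedChampion
import HarnessLib

/-!
# `NoHeavyLowerTail` (stmt-CriticalPhenomena-4575) — the attached-champion inequality splits into an
# OBSERVER-DELETED form (XZ-H) and a TWO-RELAY TRANSFER (TR)

Lead of the crux, 2026-08-18.  Notation as in `…AttachedChampion.lean`: `μ_w = prodBernoulli w` on `Fin n`, relays `A`,
observer `o ∉ A`, level `j`, `N = |π(o)|`, `R_a = {|π(a)| ≤ j}`, `𝔸 = {1 ≤ N}`; and `w ∖ o` = the weights with every pair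
at `o` set to `0` (the observer deleted; written inline as `fun e => if o ∈ e then 0 else w e`).

* **XZ-H** (hypothesis `hXZH`, registered stub `stub_attachedChampionDeleted`): if `q ∈ A` is a level-`j` champion of the
  observer-DELETED graph (`μ_{w∖o}(R_a) ≤ μ_{w∖o}(R_q)` for all `a ∈ A`), then `μ_w(1 ≤ N ≤ j) ≤ μ_w(R_q ∩ 𝔸)`.
  (By the cluster-hit decomposition this is equivalent to CS⁺(W, q) for the Steiner port sets `W ⊆ N(o)`; relay-containing
  port sets are the tree's `observerSet_le_of_lonelier`.)
* **TR** (hypothesis `hTR`, registered stub `stub_transferAttached`): for relays `a, q`: if `μ_{w∖o}(R_a) ≤ μ_{w∖o}(R_q)` and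
  `μ_w(R_q) ≤ μ_w(R_a)` then `μ_w(R_q ∩ 𝔸) ≤ μ_w(R_a ∩ 𝔸)` — "if adding the observer reverses the loneliness order of two
  relays, the new order also holds on `{o ↔ A}`".  A three-terminal statement (`a, q, o`) without any champion, of the
  van den Berg–Häggström–Kahn / tripod-exchange flavour.  Census: 0 violations / 6 364 random pairs + 40 adversarial climbs.
* `attachedChampion_of_deleted_of_transfer` : XZ-H ∧ TR ⇒ `stub_attachedChampion` (hence ⇒ CIL ⇒ the crux, by
  `noHeavyLowerTail_of_attachedChampion`).  Proof: take a champion `q_H` of `w ∖ o`; XZ-H gives `μ(L) ≤ μ(R_{q_H} ∩ 𝔸)`; the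
  champion `q` of `w` satisfies both hypotheses of TR against `q_H`.
Numerically (lab/t_thresh.py) the whole up-set `{a : μ_w(R_a) ≥ μ_w(R_{q_H})}` consists of XZ-witnesses (0/1089).
-/

noncomputable section

namespace Summit.CriticalPhenomena.PercolationContinuityZ3.Theorems

open MeasureTheory Set Literature.Probability.LatticeModels Literature.Probability.Percolation
open scoped Classical BigOperators

open MergeStability in
/-- **XZ-H and TR imply the attached-champion inequality** (`stub_attachedChampion`), hence the cumulative
isolation lemma and the crux. -/
theorem attachedChampion_of_deleted_of_transfer
    (hXZH : ∀ (n : ℕ) (w : Sym2 (Fin n) → unitInterval) (A : Finset (Fin n)) (o q : Fin n) (j : ℕ),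
      o ∉ A → q ∈ A →
      (∀ a ∈ A,
        (Literature.Probability.LatticeModels.prodBernoulli (fun e => if o ∈ e then 0 else w e)).real
            {ω : Literature.Probability.Percolation.BondConfig (Fin n) |
              (A.filter fun x => ω ∈ Literature.Probability.Percolation.openConn a x).card ≤ j} ≤
          (Literature.Probability.LatticeModels.prodBernoulli (fun e => if o ∈ e then 0 else w e)).real
            {ω : Literature.Probability.Percolation.BondConfig (Fin n) |
              (A.filter fun x => ω ∈ Literature.Probability.Percolation.openConn q x).card ≤ j}) →
      (Literature.Probability.LatticeModels.prodBernoulli w).real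
          {ω : Literature.Probability.Percolation.BondConfig (Fin n) |
            1 ≤ (A.filter fun x => ω ∈ Literature.Probability.Percolation.openConn o x).card ∧
              (A.filter fun x => ω ∈ Literature.Probability.Percolation.openConn o x).card ≤ j} ≤
        (Literature.Probability.LatticeModels.prodBernoulli w).real
          {ω : Literature.Probability.Percolation.BondConfig (Fin n) |
            (A.filter fun x => ω ∈ Literature.Probability.Percolation.openConn q x).card ≤ j ∧
              1 ≤ (A.filter fun x => ω ∈ Literature.Probability.Percolation.openConn o x).card})
    (hTR : ∀ (n : ℕ) (w : Sym2 (Fin n) → unitInterval) (A : Finset (Fin n)) (o a q : Fin n) (j : ℕ),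
      o ∉ A → a ∈ A → q ∈ A →
      (Literature.Probability.LatticeModels.prodBernoulli (fun e => if o ∈ e then 0 else w e)).real
          {ω : Literature.Probability.Percolation.BondConfig (Fin n) |
            (A.filter fun x => ω ∈ Literature.Probability.Percolation.openConn a x).card ≤ j} ≤
        (Literature.Probability.LatticeModels.prodBernoulli (fun e => if o ∈ e then 0 else w e)).real
          {ω : Literature.Probability.Percolation.BondConfig (Fin n) |
            (A.filter fun x => ω ∈ Literature.Probability.Percolation.openConn q x).card ≤ j} →
      (Literature.Probability.LatticeModels.prodBernoulli w).real
          {ω : Literature.Probability.Percolation.BondConfig (Fin n) |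
            (A.filter fun x => ω ∈ Literature.Probability.Percolation.openConn q x).card ≤ j} ≤
        (Literature.Probability.LatticeModels.prodBernoulli w).real
          {ω : Literature.Probability.Percolation.BondConfig (Fin n) |
            (A.filter fun x => ω ∈ Literature.Probability.Percolation.openConn a x).card ≤ j} →
      (Literature.Probability.LatticeModels.prodBernoulli w).real
          {ω : Literature.Probability.Percolation.BondConfig (Fin n) |
            (A.filter fun x => ω ∈ Literature.Probability.Percolation.openConn q x).card ≤ j ∧
              1 ≤ (A.filter fun x => ω ∈ Literature.Probability.Percolation.openConn o x).card} ≤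
        (Literature.Probability.LatticeModels.prodBernoulli w).real
          {ω : Literature.Probability.Percolation.BondConfig (Fin n) |
            (A.filter fun x => ω ∈ Literature.Probability.Percolation.openConn a x).card ≤ j ∧
              1 ≤ (A.filter fun x => ω ∈ Literature.Probability.Percolation.openConn o x).card})
    (n : ℕ) (w : Sym2 (Fin n) → unitInterval) (A : Finset (Fin n)) (o q : Fin n) (j : ℕ)
    (ho : o ∉ A) (hq : q ∈ A)
    (hchamp : ∀ a ∈ A,
      (Literature.Probability.LatticeModels.prodBernoulli w).real
          {ω : Literature.Probability.Percolation.BondConfig (Fin n) |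
            (A.filter fun x => ω ∈ Literature.Probability.Percolation.openConn a x).card ≤ j} ≤
        (Literature.Probability.LatticeModels.prodBernoulli w).real
          {ω : Literature.Probability.Percolation.BondConfig (Fin n) |
            (A.filter fun x => ω ∈ Literature.Probability.Percolation.openConn q x).card ≤ j}) :
    (Literature.Probability.LatticeModels.prodBernoulli w).real
        {ω : Literature.Probability.Percolation.BondConfig (Fin n) |
          1 ≤ (A.filter fun x => ω ∈ Literature.Probability.Percolation.openConn o x).card ∧
            (A.filter fun x => ω ∈ Literature.Probability.Percolation.openConn o x).card ≤ j} ≤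
      (Literature.Probability.LatticeModels.prodBernoulli w).real
        {ω : Literature.Probability.Percolation.BondConfig (Fin n) |
          (A.filter fun x => ω ∈ Literature.Probability.Percolation.openConn q x).card ≤ j ∧
            1 ≤ (A.filter fun x => ω ∈ Literature.Probability.Percolation.openConn o x).card} := by
  obtain ⟨qH, hqH, hchampH⟩ := exists_champion (prodBernoulli (fun e => if o ∈ e then 0 else w e)) A ⟨q, hq⟩ j
  exact (hXZH n w A o qH j ho hqH hchampH).trans (hTR n w A o q qH j ho hq hqH (hchampH q hq) (hchamp qH hqH))

/-- **Corollary: XZ-H and TR close the crux `NoHeavyLowerTail`.** -/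
theorem noHeavyLowerTail_of_deleted_of_transfer
    (hXZH : ∀ (n : ℕ) (w : Sym2 (Fin n) → unitInterval) (A : Finset (Fin n)) (o q : Fin n) (j : ℕ),
      o ∉ A → q ∈ A →
      (∀ a ∈ A,
        (Literature.Probability.LatticeModels.prodBernoulli (fun e => if o ∈ e then 0 else w e)).real
            {ω : Literature.Probability.Percolation.BondConfig (Fin n) |
              (A.filter fun x => ω ∈ Literature.Probability.Percolation.openConn a x).card ≤ j} ≤
          (Literature.Probability.LatticeModels.prodBernoulli (fun e => if o ∈ e then 0 else w e)).real
            {ω : Literature.Probability.Percolation.BondConfig (Fin n) |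
              (A.filter fun x => ω ∈ Literature.Probability.Percolation.openConn q x).card ≤ j}) →
      (Literature.Probability.LatticeModels.prodBernoulli w).real
          {ω : Literature.Probability.Percolation.BondConfig (Fin n) |
            1 ≤ (A.filter fun x => ω ∈ Literature.Probability.Percolation.openConn o x).card ∧
              (A.filter fun x => ω ∈ Literature.Probability.Percolation.openConn o x).card ≤ j} ≤
        (Literature.Probability.LatticeModels.prodBernoulli w).real
          {ω : Literature.Probability.Percolation.BondConfig (Fin n) |
            (A.filter fun x => ω ∈ Literature.Probability.Percolation.openConn q x).card ≤ j ∧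
              1 ≤ (A.filter fun x => ω ∈ Literature.Probability.Percolation.openConn o x).card})
    (hTR : ∀ (n : ℕ) (w : Sym2 (Fin n) → unitInterval) (A : Finset (Fin n)) (o a q : Fin n) (j : ℕ),
      o ∉ A → a ∈ A → q ∈ A →
      (Literature.Probability.LatticeModels.prodBernoulli (fun e => if o ∈ e then 0 else w e)).real
          {ω : Literature.Probability.Percolation.BondConfig (Fin n) |
            (A.filter fun x => ω ∈ Literature.Probability.Percolation.openConn a x).card ≤ j} ≤
        (Literature.Probability.LatticeModels.prodBernoulli (fun e => if o ∈ e then 0 else w e)).real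
          {ω : Literature.Probability.Percolation.BondConfig (Fin n) |
            (A.filter fun x => ω ∈ Literature.Probability.Percolation.openConn q x).card ≤ j} →
      (Literature.Probability.LatticeModels.prodBernoulli w).real
          {ω : Literature.Probability.Percolation.BondConfig (Fin n) |
            (A.filter fun x => ω ∈ Literature.Probability.Percolation.openConn q x).card ≤ j} ≤
        (Literature.Probability.LatticeModels.prodBernoulli w).real
          {ω : Literature.Probability.Percolation.BondConfig (Fin n) |
            (A.filter fun x => ω ∈ Literature.Probability.Percolation.openConn a x).card ≤ j} →
      (Literature.Probability.LatticeModels.prodBernoulli w).real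
          {ω : Literature.Probability.Percolation.BondConfig (Fin n) |
            (A.filter fun x => ω ∈ Literature.Probability.Percolation.openConn q x).card ≤ j ∧
              1 ≤ (A.filter fun x => ω ∈ Literature.Probability.Percolation.openConn o x).card} ≤
        (Literature.Probability.LatticeModels.prodBernoulli w).real
          {ω : Literature.Probability.Percolation.BondConfig (Fin n) |
            (A.filter fun x => ω ∈ Literature.Probability.Percolation.openConn a x).card ≤ j ∧
              1 ≤ (A.filter fun x => ω ∈ Literature.Probability.Percolation.openConn o x).card}) :
    Summit.CriticalPhenomena.PercolationContinuityZ3.Theses.PercNearOneGluing.NoHeavyLowerTail :=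
  noHeavyLowerTail_of_attachedChampion fun n w A o q j ho hq hchamp =>
    attachedChampion_of_deleted_of_transfer hXZH hTR n w A o q j ho hq hchamp

end Summit.CriticalPhenomena.PercolationContinuityZ3.Theorems

end
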